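import Summits.QuantumFields.YangMills.Theorems.VirialFluxGapSharpTwistedLaplaceQuantitativeLaplaceMethod
import Summits.QuantumFields.YangMills.Theorems.VirialFluxGapSharpTwistedLaplaceLogAssembly
import HarnessLib

/-!
# Laplace's method with a non-degenerate MANIFOLD of minima and an EXPLICIT, DIMENSION-POLYNOMIAL remainder `O(1/β)`
# (the quantitative Morse–Bott ∕ fibred form; free-hands support of ⟨stmt-QuantumFields-24197⟩ `SwapVirialDeficit.SwapGluedStiffness`)

Generic real analysis (namespace `Summit.QuantumFields.YangMills.Theorems.QuantitativeLaplace`), the quantitative twin of the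
Literature limit theorem `Literature.Analysis.Asymptotics.tendsto_laplaceMethod_fibred` (Hwang ∕ Hasenpflug–Rudolf–Sprungk: Laplace's
method when the minimum set is a manifold, in fibred coordinates `M × V`), built on the one-fibre Euclidean core with explicit constants
✓`laplaceMethod_quantitative_of_eqOn` (width seat w2 g49) exactly as the limit theorem is built on `tendsto_laplaceMethod`.

THE STATEMENT (★★★ `laplaceMethod_quantitative_fibred`).  `(M, ν)` an s-finite measure space (the base: the manifold of minima with any —
possibly `β`-dependent — weight already inside `ν` or `w₀`), `V` a real inner-product space of dimension `m` with Lebesgue measure (the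
transversal directions), a measurable field `p ↦ A p` of symmetric operators with UNIFORM coercivity `λ‖y‖² ≤ ⟪A p y, y⟫`, and on every
fibre the window data of the Euclidean core with UNIFORM constants: on the ball `‖y‖ ≤ R` the phase is `f(p,y) = ½⟪A p y,y⟫ + c(p,y) + r(p,y)`
and the amplitude `w(p,y) = w₀(p)(1 + ℓ(p,y) + e(p,y))` with `c(p,·), ℓ(p,·)` ODD, `|c| ≤ A₃‖y‖³`, `|r| ≤ A₄‖y‖⁴`, `|ℓ| ≤ D‖y‖`, `|e| ≤ G‖y‖²`,
everything jointly measurable, `0 ≤ w₀ ∈ L¹(ν)`, and the smallness of the window `A₃R + A₄R² ≤ λ/(8(m+8))`, `DR ≤ 1`, `GR² ≤ 1`.  THEN for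
every `β > 0` the tube integral is within the relative error `K/β` of the fibrewise Gaussian main term:

  `|∫_{M × B̄_R} e^{−βf} w d(ν ⊗ dy) − (2π/β)^{m/2} ∫_M w₀(p) (det A p)^{−1/2} dν(p)| ≤ (K/β) · (2π/β)^{m/2} ∫_M w₀ (det A p)^{−1/2} dν`,

with the SAME explicit constant as the one-fibre core,
`K = 16(m+8)/(λR²) + 16G(m+8)/λ + 256(A₄ + (A₃+A₄R)(D+GR))(m+8)²/λ² + 18432(A₃+A₄R)²(m+8)³/λ³` — polynomial in the dimension and in the data,
no hypothesis coupling `β` to the data or to the base.  ★★ `log_laplaceMethod_quantitative_fibred`: when `K/β ≤ 1/2` and the main term is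
positive, `|log ∫_{M×B̄_R} e^{−βf}w − (log ∫_M w₀ (det A p)^{−1/2} dν + (m/2)log(2π) − (m/2)log β)| ≤ 2K/β` — the shape
«`log Z = −(m/2)·log β + log(weighted finite-dimensional base integral) ± poly/β`».
Also recorded: ★ `integral_gaussian_fibred` (the main term as a product integral, which carries the measurability of `p ↦ det A p` for free)
and the pointwise-in-the-base form ★ `laplaceMethod_quantitative_fibre` (sections of the joint data fed to the core).

Proof: the core fibre by fibre (sections of jointly measurable functions are measurable, `measurable_prodMk_left`); the tube integrand is
bounded by `3·w₀(p)` on the ball (✓`laplace_abs_integrand_le_three`), hence integrable on `M × B̄_R` against `ν ⊗ dy` (`Integrable.mul_prod`);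
Fubini (`Measure.prod_restrict`, `integral_prod`, `Integrable.integral_prod_left`) on both the tube integral and the Gaussian main term
(✓`integral_exp_neg_mul_half_inner` fibrewise); then `‖∫(I − G)‖ ≤ ∫(K/β)·G` (`norm_integral_le_of_norm_le`).  The logarithmic form is
✓`abs_log_sub_log_le_of_abs_sub_le` + ✓`log_mul_rpow_div`.

WHY (the use; LEAD ym-line-sfw-p2 g96 memo2 «uniformity census» §3 (ii)+(iii), 2026-08-31).  The window-uniform («`L ≤ β^a`») versions of the
fixed-`L` rungs ⟨24196⟩/⟨24197⟩/⟨24194⟩ need the `≍ 18L⁴` massive directions INTEGRATED (Gaussian, with a remainder polynomial in the dimension),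
fibrewise over the finite-dimensional valley of commuting leaders ∕ hub which the landed blow-up controls; this file is that fibred layer in
generic form: feed it fibrewise Taylor data with `poly(L)` constants and it returns `log Z = −(m/2)log β + log(weighted leader integral) ± poly(L)/β`,
the shape consumed by ✓`SharpSigma.swapGluedStiffness_of_sharpSwapLaplace` (⟨24197⟩) and by the convex-transport route (⟨24196⟩).  Dyadic hub
shells with shell-dependent constants are handled by restricting `ν` (the base measure is arbitrary).

HONEST FRAMING: classical real analysis; width 0 by itself toward any lattice statement; no fibrewise Taylor data of any ring deficit are
produced here; ⟨24197⟩, ⟨24196⟩, ⟨24194⟩, ⟨24497⟩ and every rung ∕ summit statement stay OPEN; own crux ⟨22884⟩ OPEN (blocked-on ⟨19935⟩); the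
Yang–Mills mass gap is NOT proved; no summit is proved by a line.  Width seat ym-line-sfw-p2-w2 g58 (cell ym-idea-1, free hands),
`--supports stmt-QuantumFields-24197`.  THEOREMS ONLY (0 `def`, 0 `sorry`), standard axioms.

## References
* M. Hasenpflug, D. Rudolf, B. Sprungk, *Wasserstein convergence rates of increasingly concentrating probability measures*,
  Ann. Appl. Probab. 34 (2024), App. 4.1 Thm 16 ∕ Remark 17 (parametrised Laplace method), §3.1 Assumption 3. [HasenpflugRudolfSprungk2024]
* K. W. Breitung, *Asymptotic Approximations for Probability Integrals*, LNM 1592 (1994), Thm 41 p. 56, Lemma 26 p. 30 (one-fibre core). [Breitung1994]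
* R. Wong, *Asymptotic Approximations of Integrals*, SIAM Classics 34 (2001), §IX.5 (integer powers of `1/λ` at an interior
  non-degenerate critical point). [Wong2001AsymptoticApproximationsIntegrals]
-/

set_option autoImplicit false

noncomputable section

open _root_.MeasureTheory _root_.Filter _root_.Set _root_.Module _root_.Metric
open scoped _root_.Topology _root_.Real _root_.InnerProductSpace

namespace Summit.QuantumFields.YangMills.Theorems.QuantitativeLaplace

open Literature.Analysis.Asymptotics

variable {M : Type*} [MeasurableSpace M] {ν : Measure M} [SFinite ν]
variable {V : Type*} [NormedAddCommGroup V] [InnerProductSpace ℝ V] [FiniteDimensional ℝ V]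
  [MeasurableSpace V] [BorelSpace V]

/-! ## §1 The fibrewise Gaussian main term as a product integral -/

/-- ★ **The fibred Gaussian main term.**  For a jointly measurable, uniformly coercive field of symmetric operators `A p` and
`0 ≤ w₀ ∈ L¹(ν)`: the function `(p, y) ↦ w₀(p)·e^{−β·½⟪A p y, y⟫}` is `ν ⊗ dy`-integrable, `p ↦ w₀(p)(2π/β)^{m/2}(det A p)^{−1/2}` is
`ν`-integrable, and `∫_{M×V} w₀(p) e^{−β½⟪A p y,y⟫} = (2π/β)^{m/2} ∫_M w₀ (det A p)^{−1/2} dν` (Fubini + the anisotropic Gaussian fibre by fibre).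
[cite: Breitung1994, Lemma 26 (2.102), p. 30] [cite: HasenpflugRudolfSprungk2024, App. 4.1 Thm 16 (the leading coefficient c₀(θ))] -/
theorem integral_gaussian_fibred {A : M → V →ₗ[ℝ] V} (hA : ∀ p, (A p).IsSymmetric) {lam : ℝ} (hlam : 0 < lam)
    (hcoer : ∀ p (y : V), lam * ‖y‖ ^ 2 ≤ ⟪A p y, y⟫_ℝ)
    (hAm : Measurable fun z : M × V => ⟪A z.1 z.2, z.2⟫_ℝ)
    {w₀ : M → ℝ} (hw₀m : Measurable w₀) (hw₀ : ∀ p, 0 ≤ w₀ p) (hw₀i : Integrable w₀ ν) {β : ℝ} (hβ : 0 < β) :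
    Integrable (fun z : M × V => w₀ z.1 * Real.exp (-(β * ((1 / 2) * ⟪A z.1 z.2, z.2⟫_ℝ)))) (ν.prod volume) ∧
    Integrable (fun p => w₀ p * ((2 * π / β) ^ ((finrank ℝ V : ℝ) / 2) / Real.sqrt (LinearMap.det (A p)))) ν ∧
    ∫ z, w₀ z.1 * Real.exp (-(β * ((1 / 2) * ⟪A z.1 z.2, z.2⟫_ℝ))) ∂(ν.prod volume) =
      (2 * π / β) ^ ((finrank ℝ V : ℝ) / 2) * ∫ p, w₀ p / Real.sqrt (LinearMap.det (A p)) ∂ν := by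
  -- the integrand is dominated by the product `w₀(p) · e^{−(βλ/2)‖y‖²}`
  set g : M × V → ℝ := fun z => w₀ z.1 * Real.exp (-(β * ((1 / 2) * ⟪A z.1 z.2, z.2⟫_ℝ))) with hgdef
  have hgm : Measurable g := (hw₀m.comp measurable_fst).mul ((hAm.const_mul (1 / 2)).const_mul β).neg.exp
  have hdom : Integrable (fun z : M × V => w₀ z.1 * Real.exp (-(β * lam / 2) * ‖z.2‖ ^ 2)) (ν.prod volume) :=
    hw₀i.mul_prod (integrable_exp_neg_mul_norm_sq (V := V) (c := β * lam / 2) (by positivity))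
  have hgint : Integrable g (ν.prod volume) := by
    refine hdom.mono hgm.aestronglyMeasurable (Eventually.of_forall fun z => ?_)
    rw [Real.norm_eq_abs, Real.norm_eq_abs, hgdef]
    simp only [abs_mul, abs_of_nonneg (hw₀ z.1), abs_of_pos (Real.exp_pos _)]
    refine mul_le_mul_of_nonneg_left ?_ (hw₀ z.1)
    rw [Real.exp_le_exp]
    have := hcoer z.1 z.2
    nlinarith [hβ]
  -- fibrewise Gaussian
  have hfib : ∀ p, ∫ y, g (p, y) = w₀ p * ((2 * π / β) ^ ((finrank ℝ V : ℝ) / 2) / Real.sqrt (LinearMap.det (A p))) := by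
    intro p
    simp only [hgdef]
    rw [integral_const_mul, integral_exp_neg_mul_half_inner (hA p) hlam (hcoer p) hβ]
  refine ⟨hgint, ?_, ?_⟩
  · have h := hgint.integral_prod_left
    exact h.congr (Eventually.of_forall fun p => hfib p)
  · rw [integral_prod g hgint, ← integral_const_mul]
    refine integral_congr_ae (Eventually.of_forall fun p => ?_)
    dsimp only
    rw [hfib p]
    ring

/-! ## §2 The core on one fibre (sections of the joint data) -/

/-- ★ **The Euclidean core on the fibre over `p`**: the sections `y ↦ c(p,y), …` of jointly measurable data are measurable
(`measurable_prodMk_left`), so ✓`laplaceMethod_quantitative_of_eqOn` applies verbatim on the fibre.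
[cite: Breitung1994, Thm 41 p. 56] [cite: Wong2001AsymptoticApproximationsIntegrals, §IX.5] -/
theorem laplaceMethod_quantitative_fibre {A : M → V →ₗ[ℝ] V} (hA : ∀ p, (A p).IsSymmetric) {lam : ℝ} (hlam : 0 < lam)
    (hcoer : ∀ p (y : V), lam * ‖y‖ ^ 2 ≤ ⟪A p y, y⟫_ℝ)
    {R A₃ A₄ D G β : ℝ} (hR : 0 < R) (hA₃ : 0 ≤ A₃) (hA₄ : 0 ≤ A₄) (hD : 0 ≤ D) (hG : 0 ≤ G) (hβ : 0 < β)
    (hsmall : A₃ * R + A₄ * R ^ 2 ≤ lam / (8 * ((finrank ℝ V : ℝ) + 8)))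
    (hDR : D * R ≤ 1) (hGR : G * R ^ 2 ≤ 1)
    {f w c r ℓ e : M × V → ℝ} {w₀ : M → ℝ}
    (hc_meas : Measurable c) (hr_meas : Measurable r) (hℓ_meas : Measurable ℓ) (he_meas : Measurable e)
    (hw₀ : ∀ p, 0 ≤ w₀ p)
    (hc_odd : ∀ p (y : V), c (p, -y) = -c (p, y)) (hℓ_odd : ∀ p (y : V), ℓ (p, -y) = -ℓ (p, y))
    (hc : ∀ p (y : V), ‖y‖ ≤ R → |c (p, y)| ≤ A₃ * ‖y‖ ^ 3) (hr : ∀ p (y : V), ‖y‖ ≤ R → |r (p, y)| ≤ A₄ * ‖y‖ ^ 4)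
    (hℓ : ∀ p (y : V), ‖y‖ ≤ R → |ℓ (p, y)| ≤ D * ‖y‖) (he : ∀ p (y : V), ‖y‖ ≤ R → |e (p, y)| ≤ G * ‖y‖ ^ 2)
    (hf : ∀ p (y : V), ‖y‖ ≤ R → f (p, y) = (1 / 2) * ⟪A p y, y⟫_ℝ + c (p, y) + r (p, y))
    (hw : ∀ p (y : V), ‖y‖ ≤ R → w (p, y) = w₀ p * (1 + ℓ (p, y) + e (p, y))) (p : M) :
    |(∫ y in closedBall (0 : V) R, Real.exp (-(β * f (p, y))) * w (p, y)) -
        w₀ p * ((2 * π / β) ^ ((finrank ℝ V : ℝ) / 2) / Real.sqrt (LinearMap.det (A p)))| ≤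
      (16 * ((finrank ℝ V : ℝ) + 8) / (lam * R ^ 2) + 16 * G * ((finrank ℝ V : ℝ) + 8) / lam
        + 256 * (A₄ + (A₃ + A₄ * R) * (D + G * R)) * ((finrank ℝ V : ℝ) + 8) ^ 2 / lam ^ 2
        + 18432 * (A₃ + A₄ * R) ^ 2 * ((finrank ℝ V : ℝ) + 8) ^ 3 / lam ^ 3) / β *
        (w₀ p * ((2 * π / β) ^ ((finrank ℝ V : ℝ) / 2) / Real.sqrt (LinearMap.det (A p)))) :=
  laplaceMethod_quantitative_of_eqOn (A := A p) (f := fun y => f (p, y)) (w := fun y => w (p, y))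
    (c := fun y => c (p, y)) (r := fun y => r (p, y)) (ℓ := fun y => ℓ (p, y)) (e := fun y => e (p, y))
    (hA p) hlam (hcoer p) hR hA₃ hA₄ hD hG hβ (hw₀ p) hsmall hDR hGR
    (hc_meas.comp measurable_prodMk_left) (hr_meas.comp measurable_prodMk_left)
    (hℓ_meas.comp measurable_prodMk_left) (he_meas.comp measurable_prodMk_left)
    (hc_odd p) (hℓ_odd p) (hc p) (hr p) (hℓ p) (he p) (hf p) (hw p)

/-! ## §3 The fibred theorem -/

/-- ★★★ **Laplace's method with a non-degenerate manifold of minima — quantitative, dimension-polynomial remainder.**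
Under the hypotheses of the module docstring (s-finite base `(M, ν)`, `m`-dimensional transversal `V`, uniformly coercive measurable
field of symmetric fibre Hessians `A p`, fibrewise window data of ✓`laplaceMethod_quantitative_of_eqOn` with UNIFORM constants on the ball
`‖y‖ ≤ R`, jointly measurable, `0 ≤ w₀ ∈ L¹(ν)`), for every `β > 0`: the integrand `e^{−βf}w` is integrable on the tube `M × B̄_R`, the main term
`p ↦ w₀(p)(det A p)^{−1/2}` is `ν`-integrable, and
`|∫_{M×B̄_R} e^{−βf} w d(ν⊗dy) − (2π/β)^{m/2}∫_M w₀ (det A p)^{−1/2} dν| ≤ (K/β)·(2π/β)^{m/2}∫_M w₀ (det A p)^{−1/2} dν`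
with the explicit polynomial `K` of the one-fibre core.  (The quantitative twin of `Literature.Analysis.Asymptotics.tendsto_laplaceMethod_fibred`.)
[cite: HasenpflugRudolfSprungk2024, App. 4.1 Thm 16 and Remark 17 (parametrised Laplace method); §3.1 Assumption 3]
[cite: Breitung1994, Thm 41 p. 56 (one-fibre proof, made quantitative in `laplaceMethod_quantitative`)]
[cite: Wong2001AsymptoticApproximationsIntegrals, §IX.5] -/
theorem laplaceMethod_quantitative_fibred {A : M → V →ₗ[ℝ] V} (hA : ∀ p, (A p).IsSymmetric) {lam : ℝ} (hlam : 0 < lam)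
    (hcoer : ∀ p (y : V), lam * ‖y‖ ^ 2 ≤ ⟪A p y, y⟫_ℝ)
    (hAm : Measurable fun z : M × V => ⟪A z.1 z.2, z.2⟫_ℝ)
    {R A₃ A₄ D G β : ℝ} (hR : 0 < R) (hA₃ : 0 ≤ A₃) (hA₄ : 0 ≤ A₄) (hD : 0 ≤ D) (hG : 0 ≤ G) (hβ : 0 < β)
    (hsmall : A₃ * R + A₄ * R ^ 2 ≤ lam / (8 * ((finrank ℝ V : ℝ) + 8)))
    (hDR : D * R ≤ 1) (hGR : G * R ^ 2 ≤ 1)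
    {f w c r ℓ e : M × V → ℝ} {w₀ : M → ℝ}
    (hfm : Measurable f) (hwm : Measurable w)
    (hc_meas : Measurable c) (hr_meas : Measurable r) (hℓ_meas : Measurable ℓ) (he_meas : Measurable e)
    (hw₀m : Measurable w₀) (hw₀ : ∀ p, 0 ≤ w₀ p) (hw₀i : Integrable w₀ ν)
    (hc_odd : ∀ p (y : V), c (p, -y) = -c (p, y)) (hℓ_odd : ∀ p (y : V), ℓ (p, -y) = -ℓ (p, y))
    (hc : ∀ p (y : V), ‖y‖ ≤ R → |c (p, y)| ≤ A₃ * ‖y‖ ^ 3) (hr : ∀ p (y : V), ‖y‖ ≤ R → |r (p, y)| ≤ A₄ * ‖y‖ ^ 4)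
    (hℓ : ∀ p (y : V), ‖y‖ ≤ R → |ℓ (p, y)| ≤ D * ‖y‖) (he : ∀ p (y : V), ‖y‖ ≤ R → |e (p, y)| ≤ G * ‖y‖ ^ 2)
    (hf : ∀ p (y : V), ‖y‖ ≤ R → f (p, y) = (1 / 2) * ⟪A p y, y⟫_ℝ + c (p, y) + r (p, y))
    (hw : ∀ p (y : V), ‖y‖ ≤ R → w (p, y) = w₀ p * (1 + ℓ (p, y) + e (p, y))) :
    IntegrableOn (fun z : M × V => Real.exp (-(β * f z)) * w z) (univ ×ˢ closedBall (0 : V) R) (ν.prod volume) ∧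
    Integrable (fun p => w₀ p / Real.sqrt (LinearMap.det (A p))) ν ∧
    |(∫ z in univ ×ˢ closedBall (0 : V) R, Real.exp (-(β * f z)) * w z ∂(ν.prod volume)) -
        (2 * π / β) ^ ((finrank ℝ V : ℝ) / 2) * ∫ p, w₀ p / Real.sqrt (LinearMap.det (A p)) ∂ν| ≤
      (16 * ((finrank ℝ V : ℝ) + 8) / (lam * R ^ 2) + 16 * G * ((finrank ℝ V : ℝ) + 8) / lam
        + 256 * (A₄ + (A₃ + A₄ * R) * (D + G * R)) * ((finrank ℝ V : ℝ) + 8) ^ 2 / lam ^ 2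
        + 18432 * (A₃ + A₄ * R) ^ 2 * ((finrank ℝ V : ℝ) + 8) ^ 3 / lam ^ 3) / β *
        ((2 * π / β) ^ ((finrank ℝ V : ℝ) / 2) * ∫ p, w₀ p / Real.sqrt (LinearMap.det (A p)) ∂ν) := by
  set Kc : ℝ := (16 * ((finrank ℝ V : ℝ) + 8) / (lam * R ^ 2) + 16 * G * ((finrank ℝ V : ℝ) + 8) / lam
        + 256 * (A₄ + (A₃ + A₄ * R) * (D + G * R)) * ((finrank ℝ V : ℝ) + 8) ^ 2 / lam ^ 2
        + 18432 * (A₃ + A₄ * R) ^ 2 * ((finrank ℝ V : ℝ) + 8) ^ 3 / lam ^ 3) with hKc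
  set B : Set V := closedBall (0 : V) R with hBdef
  have hBm : MeasurableSet B := measurableSet_closedBall
  set cpow : ℝ := (2 * π / β) ^ ((finrank ℝ V : ℝ) / 2) with hcpow
  have hcpow_pos : 0 < cpow := Real.rpow_pos_of_pos (by positivity) _
  -- the fibrewise Gaussian main term `𝔊 p` and its weighted version
  set 𝔊 : M → ℝ := fun p => cpow / Real.sqrt (LinearMap.det (A p)) with h𝔊
  -- the tube integrand
  set F : M × V → ℝ := fun z => Real.exp (-(β * f z)) * w z with hFdef
  have hFm : Measurable F := ((hfm.const_mul β).neg.exp).mul hwm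
  -- (1) the pointwise core on each fibre
  have hcore : ∀ p, |(∫ y in B, F (p, y)) - w₀ p * 𝔊 p| ≤ Kc / β * (w₀ p * 𝔊 p) := fun p =>
    laplaceMethod_quantitative_fibre hA hlam hcoer hR hA₃ hA₄ hD hG hβ hsmall hDR hGR hc_meas hr_meas hℓ_meas he_meas hw₀
      hc_odd hℓ_odd hc hr hℓ he hf hw p
  -- (2) the tube integrand is bounded by `3 w₀(p)` on the ball, hence integrable on the tube
  have hFbd : ∀ z ∈ (univ : Set M) ×ˢ B, |F z| ≤ 3 * w₀ z.1 := by
    rintro ⟨p, y⟩ ⟨-, hy⟩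
    have hyR : ‖y‖ ≤ R := by simpa [hBdef] using hy
    have h3 := laplace_abs_integrand_le_three (A := A p) hlam (hcoer p) hA₃ hA₄ hD hG hβ hsmall hDR hGR
      (hc p) (hr p) (hℓ p) (he p) y hyR
    have hFy : F (p, y) = w₀ p * (Real.exp (-(β * (((1 / 2) * ⟪A p y, y⟫_ℝ) + c (p, y) + r (p, y)))) *
        (1 + ℓ (p, y) + e (p, y))) := by
      simp only [hFdef]
      rw [hf p y hyR, hw p y hyR]
      ring
    rw [hFy, abs_mul, abs_of_nonneg (hw₀ p)]
    calc w₀ p * |Real.exp (-(β * (((1 / 2) * ⟪A p y, y⟫_ℝ) + c (p, y) + r (p, y)))) * (1 + ℓ (p, y) + e (p, y))|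
        ≤ w₀ p * 3 := mul_le_mul_of_nonneg_left h3 (hw₀ p)
      _ = 3 * w₀ p := by ring
  haveI : IsFiniteMeasure ((volume : Measure V).restrict B) := by
    rw [hBdef]
    exact isFiniteMeasure_restrict.mpr measure_closedBall_lt_top.ne
  have hprod : (ν.prod volume).restrict ((univ : Set M) ×ˢ B) = ν.prod ((volume : Measure V).restrict B) := by
    rw [← Measure.prod_restrict, Measure.restrict_univ]
  have hdom : Integrable (fun z : M × V => (3 * w₀ z.1) * (1 : ℝ)) (ν.prod ((volume : Measure V).restrict B)) :=
    (hw₀i.const_mul 3).mul_prod (integrable_const (1 : ℝ))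
  have hFint : Integrable F (ν.prod ((volume : Measure V).restrict B)) := by
    refine hdom.mono hFm.aestronglyMeasurable ?_
    have hB_ae : ∀ᵐ z ∂(ν.prod ((volume : Measure V).restrict B)), z ∈ (univ : Set M) ×ˢ B := by
      rw [← hprod]
      exact ae_restrict_mem (MeasurableSet.univ.prod hBm)
    filter_upwards [hB_ae] with z hz
    rw [Real.norm_eq_abs, Real.norm_eq_abs, mul_one, abs_of_nonneg (by linarith [hw₀ z.1] : (0 : ℝ) ≤ 3 * w₀ z.1)]
    exact hFbd z hz
  have hFon : IntegrableOn F ((univ : Set M) ×ˢ B) (ν.prod volume) := by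
    rw [IntegrableOn, hprod]
    exact hFint
  -- (3) Fubini for the tube integral
  have htube : ∫ z in (univ : Set M) ×ˢ B, F z ∂(ν.prod volume) = ∫ p, (∫ y in B, F (p, y)) ∂ν := by
    rw [hprod, integral_prod F hFint]
  have hIint : Integrable (fun p => ∫ y in B, F (p, y)) ν := hFint.integral_prod_left
  -- (4) the Gaussian main term
  obtain ⟨-, hGint, hGval⟩ := integral_gaussian_fibred hA hlam hcoer hAm hw₀m hw₀ hw₀i hβ
  have hmain_int : Integrable (fun p => w₀ p * 𝔊 p) ν := hGint
  have hdet_int : Integrable (fun p => w₀ p / Real.sqrt (LinearMap.det (A p))) ν := by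
    have h := hmain_int.const_mul cpow⁻¹
    refine h.congr (Eventually.of_forall fun p => ?_)
    dsimp only
    simp only [h𝔊]
    field_simp
  have hmain_val : ∫ p, w₀ p * 𝔊 p ∂ν = cpow * ∫ p, w₀ p / Real.sqrt (LinearMap.det (A p)) ∂ν := by
    rw [← integral_const_mul]
    refine integral_congr_ae (Eventually.of_forall fun p => ?_)
    dsimp only
    simp only [h𝔊]
    ring
  -- (5) integrate the pointwise two-sided bound
  have hdiff : |(∫ p, (∫ y in B, F (p, y)) ∂ν) - ∫ p, w₀ p * 𝔊 p ∂ν| ≤ ∫ p, Kc / β * (w₀ p * 𝔊 p) ∂ν := by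
    rw [← integral_sub hIint hmain_int, ← Real.norm_eq_abs]
    refine norm_integral_le_of_norm_le (hmain_int.const_mul (Kc / β)) (Eventually.of_forall fun p => ?_)
    rw [Real.norm_eq_abs]
    exact hcore p
  refine ⟨hFon, hdet_int, ?_⟩
  rw [htube, ← hmain_val]
  calc |(∫ p, (∫ y in B, F (p, y)) ∂ν) - ∫ p, w₀ p * 𝔊 p ∂ν| ≤ ∫ p, Kc / β * (w₀ p * 𝔊 p) ∂ν := hdiff
    _ = Kc / β * ∫ p, w₀ p * 𝔊 p ∂ν := integral_const_mul _ _

/-! ## §4 The logarithmic form -/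

/-- ★★ **The fibred Laplace method in logarithmic form.**  Under the hypotheses of `laplaceMethod_quantitative_fibred`, if moreover
`K/β ≤ 1/2` and the base integral `J = ∫_M w₀ (det A p)^{−1/2} dν` is positive, then the tube integral is positive and
`|log ∫_{M×B̄_R} e^{−βf} w − (log J + (m/2)·log(2π) − (m/2)·log β)| ≤ 2K/β`
— «`log Z = −(m/2) log β + log(weighted base integral) ± poly/β`», the shape consumed by convex transport ∕ the sharp-Laplace reductions.
[cite: HasenpflugRudolfSprungk2024, App. 4.1 Thm 16] [cite: Breitung1994, Thm 41 p. 56] -/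
theorem log_laplaceMethod_quantitative_fibred {A : M → V →ₗ[ℝ] V} (hA : ∀ p, (A p).IsSymmetric) {lam : ℝ} (hlam : 0 < lam)
    (hcoer : ∀ p (y : V), lam * ‖y‖ ^ 2 ≤ ⟪A p y, y⟫_ℝ)
    (hAm : Measurable fun z : M × V => ⟪A z.1 z.2, z.2⟫_ℝ)
    {R A₃ A₄ D G β : ℝ} (hR : 0 < R) (hA₃ : 0 ≤ A₃) (hA₄ : 0 ≤ A₄) (hD : 0 ≤ D) (hG : 0 ≤ G) (hβ : 0 < β)
    (hsmall : A₃ * R + A₄ * R ^ 2 ≤ lam / (8 * ((finrank ℝ V : ℝ) + 8)))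
    (hDR : D * R ≤ 1) (hGR : G * R ^ 2 ≤ 1)
    {f w c r ℓ e : M × V → ℝ} {w₀ : M → ℝ}
    (hfm : Measurable f) (hwm : Measurable w)
    (hc_meas : Measurable c) (hr_meas : Measurable r) (hℓ_meas : Measurable ℓ) (he_meas : Measurable e)
    (hw₀m : Measurable w₀) (hw₀ : ∀ p, 0 ≤ w₀ p) (hw₀i : Integrable w₀ ν)
    (hc_odd : ∀ p (y : V), c (p, -y) = -c (p, y)) (hℓ_odd : ∀ p (y : V), ℓ (p, -y) = -ℓ (p, y))
    (hc : ∀ p (y : V), ‖y‖ ≤ R → |c (p, y)| ≤ A₃ * ‖y‖ ^ 3) (hr : ∀ p (y : V), ‖y‖ ≤ R → |r (p, y)| ≤ A₄ * ‖y‖ ^ 4)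
    (hℓ : ∀ p (y : V), ‖y‖ ≤ R → |ℓ (p, y)| ≤ D * ‖y‖) (he : ∀ p (y : V), ‖y‖ ≤ R → |e (p, y)| ≤ G * ‖y‖ ^ 2)
    (hf : ∀ p (y : V), ‖y‖ ≤ R → f (p, y) = (1 / 2) * ⟪A p y, y⟫_ℝ + c (p, y) + r (p, y))
    (hw : ∀ p (y : V), ‖y‖ ≤ R → w (p, y) = w₀ p * (1 + ℓ (p, y) + e (p, y)))
    (hK : (16 * ((finrank ℝ V : ℝ) + 8) / (lam * R ^ 2) + 16 * G * ((finrank ℝ V : ℝ) + 8) / lam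
        + 256 * (A₄ + (A₃ + A₄ * R) * (D + G * R)) * ((finrank ℝ V : ℝ) + 8) ^ 2 / lam ^ 2
        + 18432 * (A₃ + A₄ * R) ^ 2 * ((finrank ℝ V : ℝ) + 8) ^ 3 / lam ^ 3) / β ≤ 1 / 2)
    (hJ : 0 < ∫ p, w₀ p / Real.sqrt (LinearMap.det (A p)) ∂ν) :
    0 < ∫ z in univ ×ˢ closedBall (0 : V) R, Real.exp (-(β * f z)) * w z ∂(ν.prod volume) ∧
    |Real.log (∫ z in univ ×ˢ closedBall (0 : V) R, Real.exp (-(β * f z)) * w z ∂(ν.prod volume)) -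
        (Real.log (∫ p, w₀ p / Real.sqrt (LinearMap.det (A p)) ∂ν) + ((finrank ℝ V : ℝ) / 2) * Real.log (2 * π) -
          ((finrank ℝ V : ℝ) / 2) * Real.log β)| ≤
      2 * ((16 * ((finrank ℝ V : ℝ) + 8) / (lam * R ^ 2) + 16 * G * ((finrank ℝ V : ℝ) + 8) / lam
        + 256 * (A₄ + (A₃ + A₄ * R) * (D + G * R)) * ((finrank ℝ V : ℝ) + 8) ^ 2 / lam ^ 2
        + 18432 * (A₃ + A₄ * R) ^ 2 * ((finrank ℝ V : ℝ) + 8) ^ 3 / lam ^ 3) / β) := by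
  obtain ⟨-, -, hbd⟩ := laplaceMethod_quantitative_fibred hA hlam hcoer hAm hR hA₃ hA₄ hD hG hβ hsmall hDR hGR hfm hwm hc_meas
    hr_meas hℓ_meas he_meas hw₀m hw₀ hw₀i hc_odd hℓ_odd hc hr hℓ he hf hw
  set J : ℝ := ∫ p, w₀ p / Real.sqrt (LinearMap.det (A p)) ∂ν with hJdef
  have hcpow_pos : 0 < (2 * π / β) ^ ((finrank ℝ V : ℝ) / 2) := Real.rpow_pos_of_pos (by positivity) _
  have hGpos : 0 < (2 * π / β) ^ ((finrank ℝ V : ℝ) / 2) * J := mul_pos hcpow_pos hJ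
  obtain ⟨hIpos, hlog⟩ := abs_log_sub_log_le_of_abs_sub_le hGpos hK hbd
  refine ⟨hIpos, ?_⟩
  have hmain : Real.log ((2 * π / β) ^ ((finrank ℝ V : ℝ) / 2) * J) =
      Real.log J + ((finrank ℝ V : ℝ) / 2) * Real.log (2 * π) - ((finrank ℝ V : ℝ) / 2) * Real.log β := by
    rw [mul_comm]
    exact log_mul_rpow_div J _ β hJ hβ
  rw [← hmain]
  exact hlog

end Summit.QuantumFields.YangMills.Theorems.QuantitativeLaplace

end
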